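import Literature.Probability.RandomPlanarGeometry.SlitIncrement
import Literature.Probability.RandomPlanarGeometry.HydrodynamicMaps
import Literature.Probability.RandomPlanarGeometry.CaratheodoryHalfPlane
import HarnessLib

/-!
# The maps `g_t`, the half-plane capacity `b(t)` and the driving function `U_t` of a slit

G. F. Lawler, *Conformally Invariant Processes in the Plane*, AMS (2005), §4.1, p. 94: for a
simple curve `γ` from a real point, "let `g_t = g_{γ(0,t]}` be the unique conformal
transformation of `H_t` onto `ℍ` such that `g_t(z) - z → 0` … `g_t(z) = z + b(t)/z + …`,
`b(t) = hcap(γ(0,t])` … `g_{s,t} = g_{γ^s(0,t-s]}` so that `g_t = g_{s,t} ∘ g_s`", with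
"(see (3.8)) `hcap(γ^s(0,t]) = b(t+s) - b(s)`", Lemma 4.2 (`U_t = g_t(γ(t))` continuous) and
Remark 4.5 ("`b` is strictly increasing and `b(t) - b(s) ≤ c diam(γ[0,t]) diam(γ[s,t])` … in
particular, `b` is continuous"). This file assembles these objects for a slit `γ` from a positive
real point (`IsPlusSlit γ`, `SlitLanding`) from the tree's two developments: the restriction maps
`E_u = Φ_{γ[0,u]}` with their tip images `Ũ_u` (`SlitLanding`, `SlitIncrement`) and the abstract
hydrodynamic maps with their half-plane capacity (`HydrodynamicMaps`:
`IsHydrodynamicMap`, `hcap`, `diffQuotient`, `hcap_diffQuotient`, Prop. 3.46):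

* `IsPlusSlit.gmap` — **Lawler's `g_u = Φ_u - L_u : ℍ ∖ γ[0,u] → ℍ`** (`L_u = IsPlusHull.extShift`,
  `IsPlusSlit.shift`), hydrodynamically normalized (`isHydrodynamicMap_gmap`);
* `IsPlusSlit.cap u = b(u) = hcap(γ(0, u])` — **positive, strictly increasing**
  (`cap_pos`, `cap_lt_cap`), with **`b(v) - b(u) = hcap(g_u(γ(u,v]))` ≤ 288 ρ²`** when
  `|E_u(γ t) - Ũ_u| ≤ ρ` on `(u, v]` (`cap_sub_cap_le`; Remark 4.5) and `b(u) ≤ 288 ρ²` when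
  `γ[0, u] ⊆ B̄(γ(0), ρ)` (`cap_le_of_subset`);
* `IsPlusSlit.drive u = U_u = Ũ_u - L_u = lim_{t ↓ u} g_u(γ t)` (`tendsto_gmap_drive`), with
  `|U_v - U_u| ≤ 605 ρ` (`abs_drive_sub_drive_le`), so **`u ↦ U_u` is uniformly continuous**
  (`uniformContinuous_drive`, Lemma 4.2), `‖g_v - g_u‖ ≤ 580 ρ` on `ℍ ∖ γ[0, v]`
  (`norm_gmap_sub_gmap_le`, Lemma 4.1) and `|U_u - γ(0)| ≤ 19 ρ` for `γ[0,u] ⊆ B̄(γ(0), ρ)`;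
* `IsPlusSlit.norm_gmap_sub_gmap_sub_div_le` — **the increment expansion**
  `|g_v(z) - g_u(z) - (b(v) - b(u))/(g_u(z) - U_u)| ≤ 6 (b(v) - b(u)) ρ/|g_u(z) - U_u|²`
  (Prop. 3.46 for `g_{u,v}`), the source of the Loewner equation (Prop. 4.4).

## References

* G. F. Lawler (2005), §3.4 ((3.8), Prop. 3.46), §4.1 (Lemma 4.1, 4.2, Remark 4.5) [Lawler2005].
-/

noncomputable section

open Set Filter Metric Complex Bornology Function
open _root_.Topology
open UpperHalfPlane (upperHalfPlaneSet isOpen_upperHalfPlaneSet)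
open scoped ComplexConjugate

namespace Literature.Probability.RandomPlanarGeometry

namespace IsPlusSlit

variable {γ : ℝ → ℂ} (h : IsPlusSlit γ)

/-! ### The hydrodynamic maps `g_u` -/

/-- **The shift `L_u`** with `E_u(z) - z → L_u` (`IsPlusHull.extShift`; junk `0` off `(0, 1]`). [folklore] -/
def shift (u : ℝ) : ℝ :=
  if hu : 0 < u ∧ u ≤ 1 then (h.isPlusHull hu.1 hu.2).extShift (h.hull_nonempty hu.1.le) else 0

/-- `L_u` is the shift of `γ[0, u]` for `u ∈ (0, 1]`. [folklore] -/
theorem shift_eq {u : ℝ} (hu0 : 0 < u) (hu1 : u ≤ 1) :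
    h.shift u = (h.isPlusHull hu0 hu1).extShift (h.hull_nonempty hu0.le) := by
  simp [shift, hu0, hu1]

/-- **Lawler's map `g_u = Φ_u - L_u : ℍ ∖ γ[0, u] → ℍ`** for `u ∈ (0, 1]` (the restriction map
followed by the real translation by `-L_u`). [cite: Lawler2005, §4.1 (the maps g_t)] -/
def gmap {u : ℝ} (hu0 : 0 < u) (hu1 : u ≤ 1) : ConformalEquiv (upperHalfPlaneSet \ h.hull u) upperHalfPlaneSet :=
  ((h.isPlusHull hu0 hu1).baseMap (h.hull_nonempty hu0.le)).trans (addRealUpperHalfPlane (-h.shift u))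

/-- `g_u(z) = Φ_u(z) - L_u`. [folklore] -/
theorem gmap_apply {u : ℝ} (hu0 : 0 < u) (hu1 : u ≤ 1) (z : ℂ) :
    h.gmap hu0 hu1 z = (h.isPlusHull hu0 hu1).baseMap (h.hull_nonempty hu0.le) z - h.shift u := by
  simp only [gmap, ConformalEquiv.trans_apply, addRealUpperHalfPlane_apply]
  push_cast
  ring

/-- `g_u(z) = E_u(z) - L_u` on `ℍ ∖ γ[0, u]`. [folklore] -/
theorem gmap_eq_ext_sub {u : ℝ} (hu0 : 0 < u) (hu1 : u ≤ 1) {z : ℂ} (hz : z ∈ upperHalfPlaneSet \ h.hull u) :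
    h.gmap hu0 hu1 z = h.ext u z - h.shift u := by
  rw [h.gmap_apply hu0 hu1, h.ext_eq hu0 hu1, (h.isPlusHull hu0 hu1).extMap_of_mem_diff (h.hull_nonempty hu0.le) hz]

/-- **`g_u` is hydrodynamically normalized** (`g_u(z) - z → 0` at `∞` in `ℍ ∖ γ[0, u]`). [cite: Lawler2005, §4.1 (g_t(z) - z → 0)] -/
theorem isHydrodynamicMap_gmap {u : ℝ} (hu0 : 0 < u) (hu1 : u ≤ 1) :
    IsHydrodynamicMap (h.hull u) (h.gmap hu0 hu1) := by
  have hA := h.isPlusHull hu0 hu1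
  have hne := h.hull_nonempty hu0.le
  have h1 : Tendsto (fun z ↦ hA.extMap hne z - z - (hA.extShift hne : ℂ)) (cocompact ℂ) (𝓝 0) := by
    have := (hA.tendsto_extMap_sub_extShift hne).sub_const (hA.extShift hne : ℂ)
    rwa [sub_self] at this
  refine (h1.mono_left inf_le_left).congr' ?_
  filter_upwards [mem_inf_of_right (mem_principal_self (upperHalfPlaneSet \ h.hull u))] with z hz
  rw [h.gmap_eq_ext_sub hu0 hu1 hz, h.ext_eq hu0 hu1, h.shift_eq hu0 hu1]
  ring

/-- The part of `γ[0, u]` in `ℍ` lies in `B̄(γ(0), rad)`. [folklore] -/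
theorem hull_inter_subset_closedBall {u : ℝ} (hu1 : u ≤ 1) :
    h.hull u ∩ upperHalfPlaneSet ⊆ closedBall (((γ 0).re : ℝ) : ℂ) h.rad :=
  inter_subset_left.trans (h.hull_subset_closedBall hu1)

/-- The part of `γ[0, u]` in `ℍ` is bounded. [folklore] -/
theorem isBounded_hull_inter {u : ℝ} (hu1 : u ≤ 1) : IsBounded (h.hull u ∩ upperHalfPlaneSet) :=
  isBounded_closedBall.subset (h.hull_inter_subset_closedBall hu1)

/-- `|g_u(z) - z| ≤ 18ρ` on `ℍ ∖ γ[0, u]` when `γ[0, u] ⊆ B̄(x, ρ)` (`x` real). [cite: Lawler2005, Cor. 3.44 (3.12)] -/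
theorem norm_gmap_sub_self_le {u : ℝ} (hu0 : 0 < u) (hu1 : u ≤ 1) {x ρ : ℝ} (hρ : 0 < ρ)
    (hsub : h.hull u ⊆ closedBall (x : ℂ) ρ) {z : ℂ} (hz : z ∈ upperHalfPlaneSet \ h.hull u) :
    ‖h.gmap hu0 hu1 z - z‖ ≤ 18 * ρ := by
  have hA := h.isPlusHull hu0 hu1
  have hne := h.hull_nonempty hu0.le
  rw [h.gmap_eq_ext_sub hu0 hu1 hz, h.ext_eq hu0 hu1, h.shift_eq hu0 hu1]
  have h1 := hA.norm_extMap_sub_extShift_sub_le hne hρ hsub (hA.diff_subset_plusDomain hz)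
  linarith

/-! ### The half-plane capacity `b(u)` -/

/-- **`b(u) = hcap(γ(0, u])`** (`HydrodynamicMaps.hcap` of `g_u`; `0` off `(0, 1]`, in
particular `b(0) = 0`). [cite: Lawler2005, §4.1 (b(t) = hcap(γ(0,t]))] -/
def cap (u : ℝ) : ℝ := if hu : 0 < u ∧ u ≤ 1 then hcap (h.hull u) (h.gmap hu.1 hu.2) else 0

/-- `b(u) = hcap` for `u ∈ (0, 1]`. [folklore] -/
theorem cap_eq {u : ℝ} (hu0 : 0 < u) (hu1 : u ≤ 1) : h.cap u = hcap (h.hull u) (h.gmap hu0 hu1) := by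
  simp [cap, hu0, hu1]

/-- `b(0) = 0`. [folklore] -/
@[simp] theorem cap_zero : h.cap 0 = 0 := by simp [cap]

/-- **`b(u) > 0` for `u ∈ (0, 1]`** (`hcap > 0` for a nonempty hull, Lawler (3.8)/(3.10)). [cite: Lawler2005, §3.4 (3.10)] -/
theorem cap_pos {u : ℝ} (hu0 : 0 < u) (hu1 : u ≤ 1) : 0 < h.cap u := by
  rw [h.cap_eq hu0 hu1]
  exact (h.isHydrodynamicMap_gmap hu0 hu1).hcap_pos (h.isBounded_hull_inter hu1)
    ⟨γ u, ⟨u, ⟨hu0.le, le_rfl⟩, rfl⟩, h.im_pos u ⟨hu0, hu1⟩⟩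

/-- `b(u) ≥ 0` on `[0, 1]`. [folklore] -/
theorem cap_nonneg {u : ℝ} (hu0 : 0 ≤ u) (hu1 : u ≤ 1) : 0 ≤ h.cap u := by
  rcases hu0.eq_or_lt with rfl | hpos
  · simp
  · exact (h.cap_pos hpos hu1).le

/-- **`b(u) ≤ 288 ρ²` when `γ[0, u] ⊆ B̄(x, ρ)`** (Lawler (3.9), `hcap ≤ rad²`, with the constant
of `HydrodynamicMaps.hcap_le`). [cite: Lawler2005, §3.4 (3.9)] -/
theorem cap_le_of_subset {u : ℝ} (hu0 : 0 < u) (hu1 : u ≤ 1) {x ρ : ℝ} (hρ : 0 < ρ)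
    (hsub : h.hull u ⊆ closedBall (x : ℂ) ρ) : h.cap u ≤ 288 * ρ ^ 2 := by
  rw [h.cap_eq hu0 hu1]
  exact (h.isHydrodynamicMap_gmap hu0 hu1).hcap_le (inter_subset_left.trans hsub) hρ

/-! ### The increments `g_{u,v}` and `b(v) - b(u)` -/

/-- `ℍ ∖ γ[0, v] ⊆ ℍ ∖ γ[0, u]` for `u ≤ v`. [folklore] -/
theorem diff_subset_diff {u v : ℝ} (huv : u ≤ v) : upperHalfPlaneSet \ h.hull v ⊆ upperHalfPlaneSet \ h.hull u :=
  fun _ hz ↦ ⟨hz.1, fun h' ↦ hz.2 (h.hull_mono huv h')⟩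

/-- **The hull of the increment map is `g_u(γ(u, v])`.** [cite: Lawler2005, §4.1 (γ^s(0, t-s])] -/
theorem diffImage_gmap {u v : ℝ} (hu0 : 0 < u) (hu1 : u ≤ 1) (hv1 : v ≤ 1) :
    diffImage (h.gmap hu0 hu1) (h.hull v) = h.gmap hu0 hu1 '' (γ '' Ioc u v) := by
  rw [diffImage, ← h.hull_diff_hull_inter hu0.le hv1]
  congr 1
  ext z
  simp only [mem_inter_iff, Set.mem_sdiff]
  tauto

/-- **`b(v) - b(u) = hcap(g_u(γ(u, v]))`** (additivity (3.8), `hcap_diffQuotient`). [cite: Lawler2005, §3.4 (3.8)] -/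
theorem cap_sub_cap_eq {u v : ℝ} (hu0 : 0 < u) (huv : u ≤ v) (hv1 : v ≤ 1) :
    h.cap v - h.cap u = hcap (diffImage (h.gmap hu0 (huv.trans hv1)) (h.hull v))
      (diffQuotient (h.gmap hu0 (huv.trans hv1)) (h.gmap (hu0.trans_le huv) hv1) (h.diff_subset_diff huv)) := by
  rw [h.cap_eq hu0 (huv.trans hv1), h.cap_eq (hu0.trans_le huv) hv1]
  exact ((h.isHydrodynamicMap_gmap hu0 (huv.trans hv1)).hcap_diffQuotient
    (h.isHydrodynamicMap_gmap (hu0.trans_le huv) hv1) (h.isBounded_hull_inter (huv.trans hv1))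
    (h.isBounded_hull_inter hv1) (h.diff_subset_diff huv)).symm

/-- **`b` is strictly increasing on `(0, 1]`** (the increment hull is nonempty). [cite: Lawler2005, Remark 4.5] -/
theorem cap_lt_cap {u v : ℝ} (hu0 : 0 < u) (huv : u < v) (hv1 : v ≤ 1) : h.cap u < h.cap v := by
  have hu1 : u ≤ 1 := huv.le.trans hv1
  have h1 := h.cap_sub_cap_eq hu0 huv.le hv1
  have hq := (h.isHydrodynamicMap_gmap hu0 hu1).diffQuotient (h.isHydrodynamicMap_gmap (hu0.trans huv) hv1)
    (h.isBounded_hull_inter hu1) (h.diff_subset_diff huv.le)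
  have hb := (h.isHydrodynamicMap_gmap hu0 hu1).isBounded_diffImage (K₂ := h.hull v) (h.isBounded_hull_inter hu1)
    (h.isBounded_hull_inter hv1)
  have hne : (diffImage (h.gmap hu0 hu1) (h.hull v) ∩ upperHalfPlaneSet).Nonempty := by
    have hmem : γ v ∈ upperHalfPlaneSet \ h.hull u := h.apply_mem_diff hu0.le huv hv1
    refine ⟨h.gmap hu0 hu1 (γ v), ?_, (h.gmap hu0 hu1).mapsTo hmem⟩
    rw [h.diffImage_gmap hu0 hu1 hv1]
    exact ⟨γ v, ⟨v, ⟨huv, le_rfl⟩, rfl⟩, rfl⟩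
  have hpos := hq.hcap_pos hb hne
  linarith

/-- `b` is strictly monotone on `[0, 1]`. [cite: Lawler2005, Remark 4.5] -/
theorem strictMonoOn_cap : StrictMonoOn h.cap (Icc 0 1) := by
  intro u hu v hv huv
  rcases hu.1.eq_or_lt with rfl | hu0
  · rw [h.cap_zero]; exact h.cap_pos huv hv.2
  · exact h.cap_lt_cap hu0 huv hv.2

/-! ### The driving function `U_u = Ũ_u - L_u` -/

/-- **The driving function `U_u = g_u(γ(u)) = Ũ_u - L_u`** (Lawler's `U_t`, Lemma 4.2; junk off
`(0, 1)` inherited from `landing` and `shift`). [cite: Lawler2005, Lemma 4.2] -/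
def drive (u : ℝ) : ℝ := (h.landing u).re - h.shift u

/-- `g_u(γ t) - U_u = E_u(γ t) - Ũ_u` for `t ∈ (u, 1]`: the shifts cancel. [folklore] -/
theorem gmap_apply_sub_drive {u t : ℝ} (hu0 : 0 < u) (hu1 : u < 1) (hut : u < t) (ht1 : t ≤ 1) :
    h.gmap hu0 hu1.le (γ t) - h.drive u = h.ext u (γ t) - h.landing u := by
  rw [h.gmap_eq_ext_sub hu0 hu1.le (h.apply_mem_diff hu0.le hut ht1), drive]
  conv_rhs => rw [h.landing_eq_ofReal hu0 hu1]
  push_cast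
  ring

/-- **`g_u(γ t) → U_u` as `t ↓ u`** (Lemma 4.2). [cite: Lawler2005, Lemma 4.2] -/
theorem tendsto_gmap_drive {u : ℝ} (hu0 : 0 < u) (hu1 : u < 1) :
    Tendsto (fun t ↦ h.gmap hu0 hu1.le (γ t)) (𝓝[>] u) (𝓝 (h.drive u : ℂ)) := by
  have h1 : Tendsto (fun t ↦ h.ext u (γ t) - (h.shift u : ℂ)) (𝓝[>] u) (𝓝 (h.landing u - h.shift u)) :=
    (h.tendsto_landing hu0 hu1).sub_const _
  have heq : (h.drive u : ℂ) = h.landing u - h.shift u := by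
    conv_rhs => rw [h.landing_eq_ofReal hu0 hu1]
    rw [drive]; push_cast; ring
  rw [heq]
  refine h1.congr' ?_
  filter_upwards [Ioo_mem_nhdsGT hu1] with t ht
  rw [h.gmap_eq_ext_sub hu0 hu1.le (h.apply_mem_diff hu0.le ht.1 ht.2.le)]

/-- The increment hull lies in `B̄(U_u, ρ)` when `|E_u(γ t) - Ũ_u| ≤ ρ` on `(u, v]`. [folklore] -/
theorem diffImage_inter_subset_closedBall {u v : ℝ} (hu0 : 0 < u) (hu1 : u < 1) (hv1 : v ≤ 1) {ρ : ℝ}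
    (hgrowth : ∀ t ∈ Ioc u v, ‖h.ext u (γ t) - h.landing u‖ ≤ ρ) :
    diffImage (h.gmap hu0 hu1.le) (h.hull v) ∩ upperHalfPlaneSet ⊆ closedBall ((h.drive u : ℝ) : ℂ) ρ := by
  rw [h.diffImage_gmap hu0 hu1.le hv1]
  rintro _ ⟨⟨_, ⟨t, ht, rfl⟩, rfl⟩, -⟩
  rw [mem_closedBall, dist_eq_norm, h.gmap_apply_sub_drive hu0 hu1 ht.1 (ht.2.trans hv1)]
  exact hgrowth t ht

/-- **`b(v) - b(u) ≤ 288 ρ²`** when `|E_u(γ t) - Ũ_u| ≤ ρ` on `(u, v]` (Remark 4.5: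
`b(t) - b(s) ≤ c … diam(γ[s,t])`, here through `hcap ≤ 288 rad²` of the increment hull).
[cite: Lawler2005, Remark 4.5] -/
theorem cap_sub_cap_le {u v : ℝ} (hu0 : 0 < u) (hu1 : u < 1) (huv : u ≤ v) (hv1 : v ≤ 1) {ρ : ℝ}
    (hρ : 0 < ρ) (hgrowth : ∀ t ∈ Ioc u v, ‖h.ext u (γ t) - h.landing u‖ ≤ ρ) :
    h.cap v - h.cap u ≤ 288 * ρ ^ 2 := by
  rw [h.cap_sub_cap_eq hu0 huv hv1]
  have hq := (h.isHydrodynamicMap_gmap hu0 hu1.le).diffQuotient (h.isHydrodynamicMap_gmap (hu0.trans_le huv) hv1)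
    (h.isBounded_hull_inter hu1.le) (h.diff_subset_diff huv)
  exact hq.hcap_le (h.diffImage_inter_subset_closedBall hu0 hu1 hv1 hgrowth) hρ

/-- **Lawler's Lemma 4.1 for `g`: `‖g_v - g_u‖ ≤ 580 ρ` on `ℍ ∖ γ[0, v]`** when
`|E_u(γ t) - Ũ_u| ≤ ρ` on `(u, v]` (the displacement bound of `HydrodynamicMaps` for the
increment map `g_{u,v}`). [cite: Lawler2005, Lemma 4.1] -/
theorem norm_gmap_sub_gmap_le {u v : ℝ} (hu0 : 0 < u) (hu1 : u < 1) (huv : u < v) (hv1 : v ≤ 1)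
    {ρ : ℝ} (hρ : 0 < ρ) (hgrowth : ∀ t ∈ Ioc u v, ‖h.ext u (γ t) - h.landing u‖ ≤ ρ)
    {z : ℂ} (hz : z ∈ upperHalfPlaneSet \ h.hull v) :
    ‖h.gmap (hu0.trans huv) hv1 z - h.gmap hu0 hu1.le z‖ ≤ 580 * ρ := by
  have hq := (h.isHydrodynamicMap_gmap hu0 hu1.le).diffQuotient (h.isHydrodynamicMap_gmap (hu0.trans huv) hv1)
    (h.isBounded_hull_inter hu1.le) (h.diff_subset_diff huv.le)
  have hw : h.gmap hu0 hu1.le z ∈ upperHalfPlaneSet \ diffImage (h.gmap hu0 hu1.le) (h.hull v) := by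
    rw [diff_diffImage_eq (h.diff_subset_diff huv.le)]; exact ⟨z, hz, rfl⟩
  have h1 := hq.norm_sub_self_le (h.diffImage_inter_subset_closedBall hu0 hu1 hv1 hgrowth) hρ hw
  rwa [diffQuotient_apply_apply (h.diff_subset_diff huv.le) hz] at h1

/-- A point of `ℍ` off every slit: `γ(0) + (rad + 1) i`. [folklore] -/
theorem exists_mem_diff_hull : ∃ z : ℂ, ∀ u ≤ 1, z ∈ upperHalfPlaneSet \ h.hull u := by
  refine ⟨(((γ 0).re : ℝ) : ℂ) + ((h.rad + 1 : ℝ) : ℂ) * Complex.I, fun u hu1 ↦ ⟨?_, fun hmem ↦ ?_⟩⟩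
  · show 0 < ((((γ 0).re : ℝ) : ℂ) + ((h.rad + 1 : ℝ) : ℂ) * Complex.I).im
    simp; linarith [h.rad_pos]
  · have := h.hull_subset_closedBall hu1 hmem
    rw [mem_closedBall, dist_eq_norm, add_sub_cancel_left, norm_mul, Complex.norm_real, Complex.norm_I,
      mul_one, Real.norm_eq_abs, abs_of_pos (by linarith [h.rad_pos])] at this
    linarith

/-- `|L_v - L_u| ≤ 592 ρ` (compare `‖E_v - E_u‖ ≤ 12ρ` and `‖g_v - g_u‖ ≤ 580ρ` at one point). [folklore] -/
theorem abs_shift_sub_shift_le {u v : ℝ} (hu0 : 0 < u) (hu1 : u < 1) (huv : u < v) (hv1 : v ≤ 1)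
    {ρ : ℝ} (hρ : 0 < ρ) (hgrowth : ∀ t ∈ Ioc u v, ‖h.ext u (γ t) - h.landing u‖ ≤ ρ) :
    |h.shift v - h.shift u| ≤ 592 * ρ := by
  obtain ⟨z, hz⟩ := h.exists_mem_diff_hull
  have hzv := hz v hv1
  have hzu := hz u hu1.le
  have h1 := h.norm_gmap_sub_gmap_le hu0 hu1 huv hv1 hρ hgrowth hzv
  have h2 := h.norm_ext_sub_ext_le_of_growth hu0 hu1 huv hv1 hρ hgrowth hzv
  rw [h.gmap_eq_ext_sub (hu0.trans huv) hv1 hzv, h.gmap_eq_ext_sub hu0 hu1.le hzu] at h1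
  have heq : ((h.shift v - h.shift u : ℝ) : ℂ) =
      (h.ext v z - h.ext u z) - (h.ext v z - h.shift v - (h.ext u z - h.shift u)) := by
    push_cast; ring
  rw [← Real.norm_eq_abs, ← Complex.norm_real, heq]
  exact (norm_sub_le _ _).trans (by linarith)

/-- **`|U_v - U_u| ≤ 605 ρ`** when `|E_u(γ t) - Ũ_u| ≤ ρ` on `(u, v']`, `u < v < v' ≤ 1`
(`|Ũ_v - Ũ_u| ≤ 13ρ` and `|L_v - L_u| ≤ 592ρ`). [cite: Lawler2005, Lemma 4.2] -/
theorem abs_drive_sub_drive_le {u v v' : ℝ} (hu0 : 0 < u) (huv : u < v) (hvv' : v < v') (hv'1 : v' ≤ 1)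
    {ρ : ℝ} (hρ : 0 < ρ) (hgrowth : ∀ t ∈ Ioc u v', ‖h.ext u (γ t) - h.landing u‖ ≤ ρ) :
    |h.drive v - h.drive u| ≤ 605 * ρ := by
  have hv1 : v < 1 := hvv'.trans_le hv'1
  have hu1 : u < 1 := huv.trans hv1
  have h1 := h.norm_landing_sub_landing_le hu0 huv hvv' hv'1 hρ hgrowth
  have h2 := h.abs_shift_sub_shift_le hu0 hu1 huv hv1.le hρ fun t ht ↦ hgrowth t ⟨ht.1, ht.2.trans hvv'.le⟩
  have h3 : |(h.landing v).re - (h.landing u).re| ≤ 13 * ρ := by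
    have := abs_re_le_norm (h.landing v - h.landing u)
    rw [sub_re] at this
    exact this.trans h1
  rw [drive, drive]
  have : (h.landing v).re - h.shift v - ((h.landing u).re - h.shift u) =
      ((h.landing v).re - (h.landing u).re) - (h.shift v - h.shift u) := by ring
  rw [this]
  exact (abs_sub _ _).trans (by linarith)

/-- **Lawler's Lemma 4.2: `u ↦ U_u` is uniformly continuous on `(0, 1)`.** [cite: Lawler2005, Lemma 4.2] -/
theorem uniformContinuous_drive {ε : ℝ} (hε : 0 < ε) :
    ∃ δ : ℝ, 0 < δ ∧ ∀ u v : ℝ, 0 < u → u < v → v < 1 → v < u + δ → |h.drive v - h.drive u| ≤ ε := by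
  obtain ⟨δ₀, hδ₀, hgrowth⟩ := h.uniform_local_growth (show 0 < ε / 605 by positivity)
  refine ⟨δ₀ / 2, half_pos hδ₀, fun u v hu0 huv hv1 hvδ ↦ ?_⟩
  set v' : ℝ := (v + min (u + δ₀) 1) / 2 with hv'
  have hvm : v < min (u + δ₀) 1 := lt_min (by linarith) hv1
  have hvv' : v < v' := by rw [hv']; linarith
  have hv'm : v' < min (u + δ₀) 1 := by rw [hv']; linarith
  have hv'1 : v' ≤ 1 := (hv'm.trans_le (min_le_right _ _)).le
  have hv'δ : v' < u + δ₀ := hv'm.trans_le (min_le_left _ _)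
  have key := h.abs_drive_sub_drive_le hu0 huv hvv' hv'1 (show 0 < ε / 605 by positivity)
    fun t ht ↦ hgrowth u hu0 (huv.trans hv1) t ht.1 (ht.2.trans hv'1) (lt_of_le_of_lt ht.2 hv'δ)
  linarith

/-- **The start of the driving function: `|U_u - γ(0)| ≤ 19 ρ`** when `|γ(t) - γ(0)| ≤ ρ` on
`[0, u]` (`|Ũ_u - γ(0)| ≤ 13ρ`, `|L_u| ≤ 6ρ`). [cite: Lawler2005, Lemma 4.2] -/
theorem abs_drive_sub_re_zero_le {u : ℝ} (hu0 : 0 < u) (hu1 : u < 1) {ρ : ℝ} (hρ : 0 < ρ)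
    (hγρ : ∀ t ∈ Icc 0 u, ‖γ t - γ 0‖ ≤ ρ) : |h.drive u - (γ 0).re| ≤ 19 * ρ := by
  have h1 := h.norm_landing_sub_le hu0 hu1 hρ hγρ
  have hsub : h.hull u ⊆ closedBall (((γ 0).re : ℝ) : ℂ) ρ := by
    rintro _ ⟨t, ht, rfl⟩
    rw [mem_closedBall, dist_eq_norm, h.ofReal_re_zero]
    exact hγρ t ht
  have h2 : |h.shift u| ≤ 6 * ρ := by
    rw [h.shift_eq hu0 hu1.le]
    exact (h.isPlusHull hu0 hu1.le).abs_extShift_le (h.hull_nonempty hu0.le) hρ hsub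
  have h3 : |(h.landing u).re - (γ 0).re| ≤ 13 * ρ := by
    have := abs_re_le_norm (h.landing u - γ 0)
    rw [sub_re] at this
    exact this.trans h1
  rw [drive]
  have : (h.landing u).re - h.shift u - (γ 0).re = ((h.landing u).re - (γ 0).re) - h.shift u := by ring
  rw [this]
  exact (abs_sub _ _).trans (by linarith)

/-! ### The increment expansion (Prop. 3.46 for `g_{u,v}`) -/

/-- **The increment expansion**: for `z ∈ ℍ ∖ γ[0, v]` with `|g_u(z) - U_u| ≥ 2ρ`, where
`|E_u(γ t) - Ũ_u| ≤ ρ` on `(u, v]`,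
`|g_v(z) - g_u(z) - (b(v) - b(u))/(g_u(z) - U_u)| ≤ 6 (b(v) - b(u)) ρ/|g_u(z) - U_u|²`
(Prop. 3.46, `HydrodynamicMaps.norm_sub_sub_div_le`, for the increment map `g_{u,v}` about the
real centre `U_u`; Lawler's display in the proof of Prop. 4.4). [cite: Lawler2005, Prop. 3.46 and Prop. 4.4 (proof)] -/
theorem norm_gmap_sub_gmap_sub_div_le {u v : ℝ} (hu0 : 0 < u) (hu1 : u < 1) (huv : u < v) (hv1 : v ≤ 1)
    {ρ : ℝ} (hρ : 0 < ρ) (hgrowth : ∀ t ∈ Ioc u v, ‖h.ext u (γ t) - h.landing u‖ ≤ ρ)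
    {z : ℂ} (hz : z ∈ upperHalfPlaneSet \ h.hull v)
    (h2 : 2 * ρ ≤ ‖h.gmap hu0 hu1.le z - h.drive u‖) :
    ‖h.gmap (hu0.trans huv) hv1 z - h.gmap hu0 hu1.le z - (h.cap v - h.cap u : ℂ) / (h.gmap hu0 hu1.le z - h.drive u)‖ ≤
      6 * (h.cap v - h.cap u) * ρ / ‖h.gmap hu0 hu1.le z - h.drive u‖ ^ 2 := by
  have hq := (h.isHydrodynamicMap_gmap hu0 hu1.le).diffQuotient (h.isHydrodynamicMap_gmap (hu0.trans huv) hv1)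
    (h.isBounded_hull_inter hu1.le) (h.diff_subset_diff huv.le)
  have hw : h.gmap hu0 hu1.le z ∈ upperHalfPlaneSet := (h.gmap hu0 hu1.le).mapsTo (h.diff_subset_diff huv.le hz)
  have key := hq.norm_sub_sub_div_le (h.diffImage_inter_subset_closedBall hu0 hu1 hv1 hgrowth) hρ hw h2
  rw [diffQuotient_apply_apply (h.diff_subset_diff huv.le) hz, ← h.cap_sub_cap_eq hu0 huv.le hv1] at key
  push_cast at key
  exact key

end IsPlusSlit

end Literature.Probability.RandomPlanarGeometry
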